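import Mathlib
import HarnessLib
import Summits.ABC.ABC.Statement
import Summits.ABC.ABC.Theorems.SoloBlindSquarePencilRidout
import Summits.ABC.ABC.Theorems.SoloBlindLinearPencilMatveev

/-!
# Linear pencils `x^l` vs `2^n`, part 2: fixed `(l, n mod l)` by Ridout's theorem (ineffective)

`Summits/ABC/ABC/Theorems/SoloBlindLinearPencilRidout.lean`; namespace `Summit.ABC.ABC.Theorems`
(solo seat `solo-ABC-blind`, wall coordinate T55, part 2 of 3; assembled in `SoloBlindLinearPencils`).

Granting the `p`-adic Thue–Siegel–Roth theorem for rationals — Ridout 1958 [Ridout1958]; Bombieri–Gubler, *Heights*,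
Thm. 6.2.3 with `K = ℚ`, `S ∋ ∞` [BombieriGubler2006] — as the HYPOTHESIS `hRat`, verbatim the one of
`SoloBlindSquarePencilRidout` and `Literature/…/PadicRothIntegers`: for fixed `0 < s < l` and every `ε > 0` there is
`C = C(l, s, ε)` with `max(2^{lt+s}, x^l) < C · (x · |2^{lt+s} − x^l|)^{1+ε}` for all odd `x` and all `t`
(`linearPencil_ridout`).

The argument, in the main regime `2^n < 2x^l < 4·2^n` (`n = lt + s`, `x ≥ 3`): put `ρ = 2^{n/l} = 2^t·g`,
`g = 2^{s/l} ∈ (1, 2)`, `β = 2^t/x ∈ ℚ` (lowest terms, `x` odd), `α_∞ = g⁻¹` (algebraic), `α_2 = 0`, `S = {2}`.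
Then `H(β) = max(2^t, x) < 2x` (`2^t < ρ < 2x`), `|β − g⁻¹| = g⁻¹|ρ − x|/x ≤ b/x^l`
(`|ρ − x|·x^{l−1} ≤ |ρ^l − x^l| = b`), `|β|_2 = 2^{−t} ≤ 4/x` (`x < 2ρ < 4·2^t`); so the Roth–Ridout quantity is
`≤ 4b/x^{l+1}`, and off the finite exceptional set it exceeds `H(β)^{−κ} > (2x)^{−κ}`, `κ = 2 + ε/(1+ε)`; in
log-space this gives `log M < log 2 + (4+δ')(1+ε) log 2 + (1+ε) log(xb)`; on the exceptional set `x = den β`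
is bounded, `M < 2x^l ≤ 2 Σ den^l`.  Nothing here is effective.

## References

* [Ridout1958] D. Ridout, *The p-adic generalization of the Thue–Siegel–Roth theorem*, Mathematika 5 (1958) 40–48.
* [BombieriGubler2006] E. Bombieri, W. Gubler, *Heights in Diophantine Geometry*, CUP 2006, Thm. 6.2.3.
-/

noncomputable section

namespace Summit.ABC.ABC.Theorems

open Real Literature.NumberTheory.DiophantineApproximation Literature.NumberTheory.DiophantineGeometry

/-- **Fixed `(l, s)`, `0 < s < l` (Ridout).**  Granting `hRat`: for every `ε > 0` there is `C` with
`max(2^{lt+s}, x^l) < C·(x·|2^{lt+s} − x^l|)^{1+ε}` for all odd `x` and all `t`.  Ineffective (`C` depends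
on the exceptional set of Roth–Ridout for `α_∞ = 2^{−s/l}`, `α_2 = 0`). [this project] -/
theorem linearPencil_ridout
    (hRat : ∀ (S : Finset Nat.Primes) (α₀ : ℝ), IsAlgebraic ℚ α₀ →
      ∀ (α : ∀ p : Nat.Primes, @PadicAlgCl (p : ℕ) ⟨p.2⟩), (∀ p ∈ S, IsAlgebraic ℚ (α p)) →
      ∀ κ : ℝ, 2 < κ →
        {β : ℚ | min 1 |(β : ℝ) - α₀| *
            (∏ p ∈ S, min (1 : ℝ) ‖(β : @PadicAlgCl (p : ℕ) ⟨p.2⟩) - α p‖) ≤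
          (max (|(β.num : ℝ)|) (β.den : ℝ)) ^ (-κ)}.Finite)
    {l s : ℕ} (hs : 0 < s) (hsl : s < l) {ε : ℝ} (hε : 0 < ε) :
    ∃ C : ℝ, 0 < C ∧ ∀ x t : ℕ, Odd x →
      max ((2 : ℝ) ^ (l * t + s)) ((x : ℝ) ^ l) <
        C * ((x : ℝ) * |(2 : ℝ) ^ (l * t + s) - (x : ℝ) ^ l|) ^ (1 + ε) := by
  classical
  have _inst (p : Nat.Primes) : Fact (p : ℕ).Prime := ⟨p.2⟩
  have hlpos : 0 < l := by omega
  have hl0 : (0 : ℝ) < l := by exact_mod_cast hlpos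
  have hl0' : (l : ℝ) ≠ 0 := hl0.ne'
  have hs0 : (0 : ℝ) < s := by exact_mod_cast hs
  have hl1R : (1 : ℝ) ≤ l := by exact_mod_cast hlpos
  -- exponents
  set δ' : ℝ := ε / (1 + ε) with hδ'
  have hδ'0 : 0 < δ' := by positivity
  have hδε : δ' * (1 + ε) = ε := by rw [hδ']; field_simp
  have hκ : (2 : ℝ) < 2 + δ' := by linarith
  -- the algebraic target `g⁻¹`, `g = 2^{s/l} ∈ (1, 2)`
  set g : ℝ := (2 : ℝ) ^ ((s : ℝ) / (l : ℝ)) with hg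
  have hg1 : 1 < g := by rw [hg]; exact Real.one_lt_rpow one_lt_two (div_pos hs0 hl0)
  have hg2 : g < 2 := by
    have h1 : (s : ℝ) / (l : ℝ) < 1 := by rw [div_lt_one hl0]; exact_mod_cast hsl
    have h2 : (2 : ℝ) ^ ((s : ℝ) / (l : ℝ)) < (2 : ℝ) ^ (1 : ℝ) :=
      Real.rpow_lt_rpow_of_exponent_lt one_lt_two h1
    rw [Real.rpow_one] at h2
    rw [hg]; exact h2
  have hg0 : 0 < g := by linarith
  have hg0' : g ≠ 0 := hg0.ne'
  have halg : IsAlgebraic ℚ g⁻¹ := (isAlgebraic_two_rpow_div s l hlpos).inv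
  have hB := hRat ({⟨2, Nat.prime_two⟩} : Finset Nat.Primes) g⁻¹ halg (fun _ => 0)
    (fun _ _ => isAlgebraic_zero) (2 + δ') hκ
  -- the constant
  set SF : ℝ := ∑ β ∈ hB.toFinset, ((β.den : ℕ) : ℝ) ^ l with hSF
  have hSF0 : 0 ≤ SF := Finset.sum_nonneg fun β _ => by positivity
  set C₁ : ℝ := 2 * (2 : ℝ) ^ ((4 + δ') * (1 + ε)) with hC₁
  have hC₁0 : 0 < C₁ := by positivity
  refine ⟨C₁ + 2 * SF + 3, by linarith, ?_⟩
  intro x t hxodd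
  have hx1 : 1 ≤ x := hxodd.pos
  have hne : x ^ l ≠ 2 ^ (l * t + s) := by
    intro h
    have := eq_zero_of_odd_pow_eq_two_pow hxodd h
    omega
  have hYnn : (0 : ℝ) ≤ ((x : ℝ) * |(2 : ℝ) ^ (l * t + s) - (x : ℝ) ^ l|) ^ (1 + ε) :=
    Real.rpow_nonneg (mul_nonneg (by positivity) (abs_nonneg _)) _
  have hfin : ∀ {A : ℝ}, A ≤ C₁ + 2 * SF + 3 →
      max ((2 : ℝ) ^ (l * t + s)) ((x : ℝ) ^ l) <
        A * ((x : ℝ) * |(2 : ℝ) ^ (l * t + s) - (x : ℝ) ^ l|) ^ (1 + ε) →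
      max ((2 : ℝ) ^ (l * t + s)) ((x : ℝ) ^ l) <
        (C₁ + 2 * SF + 3) * ((x : ℝ) * |(2 : ℝ) ^ (l * t + s) - (x : ℝ) ^ l|) ^ (1 + ε) :=
    fun hA h => lt_of_lt_of_le h (mul_le_mul_of_nonneg_right hA hYnn)
  by_cases htriv : 2 * x ^ l ≤ 2 ^ (l * t + s) ∨ 2 * 2 ^ (l * t + s) ≤ x ^ l
  · exact hfin (by linarith) (linearPencil_trivial hε (by norm_num : (2 : ℝ) < 3) hx1 hne htriv)
  push Not at htriv
  obtain ⟨hA1, hA2⟩ := htriv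
  obtain ⟨hx3, -, -⟩ := linearPencil_main_basic hxodd hne hA1 hA2
  -- reals
  have hX : (3 : ℝ) ≤ x := by exact_mod_cast hx3
  have hX0 : (0 : ℝ) < x := by linarith
  have hX0' : (x : ℝ) ≠ 0 := hX0.ne'
  have hP0 : (0 : ℝ) < (x : ℝ) ^ l := pow_pos hX0 l
  have hT0 : (0 : ℝ) < (2 : ℝ) ^ (l * t + s) := by positivity
  have hA1R : (2 : ℝ) ^ (l * t + s) < 2 * (x : ℝ) ^ l := by exact_mod_cast hA1
  have hA2R : (x : ℝ) ^ l < 2 * (2 : ℝ) ^ (l * t + s) := by exact_mod_cast hA2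
  have hb1 : (1 : ℝ) ≤ |(2 : ℝ) ^ (l * t + s) - (x : ℝ) ^ l| := by
    have := one_le_abs_natCast_sub (Ne.symm hne)
    push_cast at this
    exact this
  set b : ℝ := |(2 : ℝ) ^ (l * t + s) - (x : ℝ) ^ l| with hbdef
  have hb0 : 0 < b := by linarith
  have hMlt : max ((2 : ℝ) ^ (l * t + s)) ((x : ℝ) ^ l) < 2 * (x : ℝ) ^ l := max_lt hA1R (by linarith)
  have hM0 : 0 < max ((2 : ℝ) ^ (l * t + s)) ((x : ℝ) ^ l) := lt_of_lt_of_le hP0 (le_max_right _ _)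
  have hxb1 : (1 : ℝ) ≤ (x : ℝ) * b := by
    have := mul_le_mul (by linarith : (1 : ℝ) ≤ x) hb1 zero_le_one hX0.le
    linarith
  have hY1 : (1 : ℝ) ≤ ((x : ℝ) * b) ^ (1 + ε) := Real.one_le_rpow hxb1 (by linarith)
  -- `ρ = 2^{n/l} = 2^t · g`
  set ρ : ℝ := (2 : ℝ) ^ (((l * t + s : ℕ) : ℝ) / (l : ℝ)) with hρ
  have hρ0 : 0 < ρ := Real.rpow_pos_of_pos two_pos _
  have hρl : ρ ^ l = (2 : ℝ) ^ (l * t + s) := two_rpow_div_pow (l * t + s) l hlpos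
  have hρt : ρ = (2 : ℝ) ^ t * g := by
    rw [hρ, hg, ← Real.rpow_natCast (2 : ℝ) t, ← Real.rpow_add two_pos]
    congr 1
    push_cast
    field_simp
  have hρ2x : ρ < 2 * x := by
    have h1 : ρ ^ l < (2 * (x : ℝ)) ^ l := by
      rw [hρl, mul_pow]
      calc (2 : ℝ) ^ (l * t + s) < 2 * (x : ℝ) ^ l := hA1R
        _ ≤ 2 ^ l * (x : ℝ) ^ l := by
            gcongr
            exact le_self_pow₀ (by norm_num) hlpos.ne'
    exact lt_of_pow_lt_pow_left₀ l (by positivity) h1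
  have hx2ρ : (x : ℝ) < 2 * ρ := by
    have h1 : (x : ℝ) ^ l < (2 * ρ) ^ l := by
      rw [mul_pow, hρl]
      calc (x : ℝ) ^ l < 2 * (2 : ℝ) ^ (l * t + s) := hA2R
        _ ≤ 2 ^ l * (2 : ℝ) ^ (l * t + s) := by
            gcongr
            exact le_self_pow₀ (by norm_num) hlpos.ne'
    exact lt_of_pow_lt_pow_left₀ l (by positivity) h1
  have h2t_lt : (2 : ℝ) ^ t < ρ := by rw [hρt]; exact lt_mul_of_one_lt_right (by positivity) hg1
  have h2t_gt : ρ < 2 * (2 : ℝ) ^ t := by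
    rw [hρt]
    have h := mul_lt_mul_of_pos_left hg2 (by positivity : (0 : ℝ) < (2 : ℝ) ^ t)
    linarith
  have hH2x : max ((2 : ℝ) ^ t) (x : ℝ) < 2 * x := max_lt (by linarith) (by linarith)
  have hinv : ((2 : ℝ) ^ t)⁻¹ ≤ 4 / x := by
    have h1 : (x : ℝ) / 4 ≤ (2 : ℝ) ^ t := by linarith
    calc ((2 : ℝ) ^ t)⁻¹ ≤ ((x : ℝ) / 4)⁻¹ := inv_anti₀ (div_pos hX0 (by norm_num)) h1
      _ = 4 / x := by rw [inv_div]
  -- archimedean estimate `|ρ − x| x^{l−1} ≤ b`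
  have hgeom : |ρ - x| * (x : ℝ) ^ (l - 1) ≤ b := by
    have h := abs_sub_mul_pow_le hρ0.le hX0.le (l - 1)
    rw [show l - 1 + 1 = l by omega, hρl] at h
    exact h
  -- the rational point `β = 2^t / x`
  have hcop : Nat.Coprime (2 ^ t) x := (Nat.coprime_two_left.mpr hxodd).pow_left t
  have hb0Z : (0 : ℤ) < ((x : ℕ) : ℤ) := by exact_mod_cast hx1
  have hcop' : Nat.Coprime ((2 ^ t : ℕ) : ℤ).natAbs ((x : ℕ) : ℤ).natAbs := by
    simpa only [Int.natAbs_natCast] using hcop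
  set β : ℚ := (((2 ^ t : ℕ) : ℤ) : ℚ) / (((x : ℕ) : ℤ) : ℚ) with hβ
  have hnum : β.num = ((2 ^ t : ℕ) : ℤ) := Rat.num_div_eq_of_coprime hb0Z hcop'
  have hden : (β.den : ℤ) = ((x : ℕ) : ℤ) := Rat.den_div_eq_of_coprime hb0Z hcop'
  have hdenN : β.den = x := by exact_mod_cast hden
  have hH : max (|(β.num : ℝ)|) (β.den : ℝ) = max ((2 : ℝ) ^ t) (x : ℝ) := by
    rw [hnum, hdenN]
    push_cast
    rw [abs_of_nonneg (by positivity)]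
  have hβR : ((β : ℚ) : ℝ) = (2 : ℝ) ^ t / x := by
    rw [hβ]; push_cast; ring
  -- local estimates
  have harch : min 1 |((β : ℚ) : ℝ) - g⁻¹| ≤ b / (x : ℝ) ^ l := by
    refine (min_le_right _ _).trans ?_
    have hβg : ((β : ℚ) : ℝ) - g⁻¹ = g⁻¹ * ((ρ - x) / x) := by
      rw [hβR, hρt]
      field_simp
    rw [hβg, abs_mul, abs_of_pos (inv_pos.mpr hg0), abs_div, abs_of_pos hX0]
    have hg1' : g⁻¹ ≤ 1 := inv_le_one_of_one_le₀ hg1.le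
    have h1 : |ρ - x| / x ≤ b / (x : ℝ) ^ l := by
      rw [div_le_div_iff₀ hX0 hP0]
      calc |ρ - ↑x| * (x : ℝ) ^ l = |ρ - ↑x| * (x : ℝ) ^ (l - 1) * x := by
            rw [mul_assoc, ← pow_succ, show l - 1 + 1 = l by omega]
        _ ≤ b * x := mul_le_mul_of_nonneg_right hgeom hX0.le
    calc g⁻¹ * (|ρ - ↑x| / ↑x) ≤ 1 * (|ρ - ↑x| / ↑x) :=
          mul_le_mul_of_nonneg_right hg1' (by positivity)
      _ ≤ b / (x : ℝ) ^ l := by rw [one_mul]; exact h1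
  have hβ2 : ‖(β : PadicAlgCl 2) - 0‖ = ((2 : ℝ) ^ t)⁻¹ := by
    rw [sub_zero, hβ]; exact norm_padicAlgCl_two_pow_div_odd t hxodd
  have hup : min 1 |((β : ℚ) : ℝ) - g⁻¹| *
      (∏ p ∈ ({⟨2, Nat.prime_two⟩} : Finset Nat.Primes),
        min (1 : ℝ) ‖(β : PadicAlgCl (p : ℕ)) - (0 : PadicAlgCl (p : ℕ))‖) ≤
      b / (x : ℝ) ^ l * ((2 : ℝ) ^ t)⁻¹ := by
    rw [Finset.prod_singleton]
    have h2 : min (1 : ℝ) ‖(β : PadicAlgCl ((⟨2, Nat.prime_two⟩ : Nat.Primes) : ℕ)) -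
        (0 : PadicAlgCl ((⟨2, Nat.prime_two⟩ : Nat.Primes) : ℕ))‖ ≤ ((2 : ℝ) ^ t)⁻¹ :=
      (min_le_right _ _).trans hβ2.le
    exact mul_le_mul harch h2 (le_min zero_le_one (norm_nonneg _)) (div_nonneg hb0.le hP0.le)
  by_cases hmem : β ∈ hB.toFinset
  · -- exceptional point: `x = den β` bounded, `x^l ≤ SF`
    have h1 : ((β.den : ℕ) : ℝ) ^ l ≤ SF :=
      Finset.single_le_sum (f := fun γ : ℚ => ((γ.den : ℕ) : ℝ) ^ l) (fun _ _ => by positivity) hmem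
    rw [hdenN] at h1
    have h2 : max ((2 : ℝ) ^ (l * t + s)) ((x : ℝ) ^ l) < (2 * SF) * ((x : ℝ) * b) ^ (1 + ε) :=
      calc max ((2 : ℝ) ^ (l * t + s)) ((x : ℝ) ^ l) < 2 * (x : ℝ) ^ l := hMlt
        _ ≤ 2 * SF := by linarith
        _ ≤ (2 * SF) * ((x : ℝ) * b) ^ (1 + ε) := le_mul_of_one_le_right (by linarith) hY1
    exact hfin (by linarith) h2
  · -- generic point
    rw [Set.Finite.mem_toFinset, Set.mem_setOf_eq, not_le, hH] at hmem
    have hlow : (2 * (x : ℝ)) ^ (-(2 + δ')) < 4 * b / (x : ℝ) ^ (l + 1) := by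
      calc (2 * (x : ℝ)) ^ (-(2 + δ')) < (max ((2 : ℝ) ^ t) (x : ℝ)) ^ (-(2 + δ')) :=
            Real.rpow_lt_rpow_of_neg (lt_max_of_lt_right hX0) hH2x (by linarith)
        _ < _ := hmem
        _ ≤ b / (x : ℝ) ^ l * ((2 : ℝ) ^ t)⁻¹ := hup
        _ ≤ b / (x : ℝ) ^ l * (4 / x) := mul_le_mul_of_nonneg_left hinv (div_nonneg hb0.le hP0.le)
        _ = 4 * b / (x : ℝ) ^ (l + 1) := by rw [div_mul_div_comm, pow_succ]; ring
    -- logs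
    have hlog4 : Real.log 4 = 2 * Real.log 2 := by
      rw [show (4 : ℝ) = 2 ^ 2 by norm_num, Real.log_pow]; push_cast; ring
    have hLb : -(2 + δ') * (Real.log 2 + Real.log x) <
        2 * Real.log 2 + Real.log b - ((l : ℝ) + 1) * Real.log x := by
      have h2x : (0 : ℝ) < 2 * x := by linarith
      have h1 := Real.log_lt_log (Real.rpow_pos_of_pos h2x _) hlow
      rw [Real.log_rpow h2x, Real.log_mul two_ne_zero hX0.ne',
        Real.log_div (mul_pos four_pos hb0).ne' (pow_pos hX0 _).ne', Real.log_mul (by norm_num) hb0.ne',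
        Real.log_pow, hlog4] at h1
      push_cast at h1
      linarith
    have hLM : Real.log (max ((2 : ℝ) ^ (l * t + s)) ((x : ℝ) ^ l)) < Real.log 2 + (l : ℝ) * Real.log x := by
      have := Real.log_lt_log hM0 hMlt
      rw [Real.log_mul two_ne_zero hP0.ne', Real.log_pow] at this
      exact this
    have hlogx0 : 0 ≤ Real.log x := Real.log_nonneg (by linarith)
    have hgoal : Real.log (max ((2 : ℝ) ^ (l * t + s)) ((x : ℝ) ^ l)) <
        (Real.log 2 + (4 + δ') * (1 + ε) * Real.log 2) + (1 + ε) * (Real.log x + Real.log b) := by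
      have g1 := mul_lt_mul_of_pos_left hLb (by linarith : (0 : ℝ) < 1 + ε)
      have g2 : 0 ≤ ε * ((l : ℝ) - 1) * Real.log x := by
        have : (0 : ℝ) ≤ (l : ℝ) - 1 := by linarith
        positivity
      have g3 : δ' * (1 + ε) * Real.log x = ε * Real.log x := by rw [hδε]
      linarith [g1, g2, g3, hLM, hlogx0]
    -- exponentiate
    have hxb0 : 0 < (x : ℝ) * b := mul_pos hX0 hb0
    have hY0 : 0 < ((x : ℝ) * b) ^ (1 + ε) := Real.rpow_pos_of_pos hxb0 _
    have hrhs : Real.log (C₁ * ((x : ℝ) * b) ^ (1 + ε)) =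
        (Real.log 2 + (4 + δ') * (1 + ε) * Real.log 2) + (1 + ε) * (Real.log x + Real.log b) := by
      rw [Real.log_mul hC₁0.ne' hY0.ne', hC₁, Real.log_mul two_ne_zero (by positivity),
        Real.log_rpow two_pos, Real.log_rpow hxb0, Real.log_mul hX0.ne' hb0.ne']
    have hlt : max ((2 : ℝ) ^ (l * t + s)) ((x : ℝ) ^ l) < C₁ * ((x : ℝ) * b) ^ (1 + ε) := by
      rw [← Real.log_lt_log_iff hM0 (mul_pos hC₁0 hY0), hrhs]; exact hgoal
    exact hfin (by linarith) hlt


end Summit.ABC.ABC.Theorems
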